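import Summits.NavierStokesRegularity.NavierStokesRegularity.Theorems.TypeICertificateLadderTargetRotatingConjugateDensityHardy
import HarnessLib

/-!
# A nonzero weak solution of the twisted weight equation `L*_J(γ v) = 0` in `H¹(γ)`
# (tools for the rotating conjugate density, stub B2 of line `killing-twisted-bernoulli-solitons`,
# crux `Target`, stmt-NavierStokesRegularity-1217)

Helper file (all results proved, no definitions, no named facts). Second of the two files that
carry the `L²(γ)` existence step of Pineau–Vicol 2026, Prop. 5.1 (B. Pineau, V. Vicol,
arXiv:2607.09619; tree: `PineauVicolWeightExistence`, drift `U + ½y` with `U` bounded) over to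
the ROTATING GAUGE, drift `U + ½y − J y` with `J` a skew linear field (for a rotated self-similar
profile of angular speed `α`: `J = α rotGen`, `⟪J y, y⟫ = 0`, `div J = 0`). Writing the weight as
`m = γ v`, `γ = e^{−|y|²/4}`, the adjoint equation `Δm + div(m (U + ½y − Jy)) = 0` becomes
`−Δv + (½y − U + Jy)·∇v + ½⟪U, y⟫ v = 0`, whose weak form on `V = H¹(γ)` is the tree's shifted
form `a_{μ₀}` plus the alternating form `R` of the previous file
(`rotatingDensity_skewForm`: `R (f,G) (f',G') = ∫ γ ⟪G, f' J y⟫`, `R x x = 0`, `R x (1,0) = 0`).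
Consequently (`exists_weak_solution_fun_rot`):

* `a_{μ₀} + R` is coercive on `V` with the SAME constant `½` (the rotation drift is
  `L²(γ)`-skew), so Lax–Milgram gives a solution operator, compact through `V ↪ L²(γ)`
  (`isCompactOperator_gaussFstL`);
* its adjoint still fixes the constants up to `μ₀⁻¹` (`R x (1,0) = 0` and the tree's
  `formBilin_gaussOnePair`), so `μ₀⁻¹` is an eigenvalue by the Fredholm alternative, and an
  eigenvector unbundles to `f ∈ L²(γ)`, `f ≠ 0`, with `γ`-weak gradient `G ∈ L²(γ; E)`,
  `|y| f ∈ L²(γ)` (Hardy on `V`), solving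
  `∫γ⟪G,∇φ⟫ − ∫γ⟪U,G⟫φ + ∫γ⟪J y, G⟫φ + ∫γ ½⟪U,y⟫ f φ = 0` for all test functions `φ`.

What is NOT here (the remaining steps of the rotating Prop. 5.1, see the adaptation map of the
line's notes): hypoelliptic regularity and the classical equation, Kato positivity, Harnack
chains and the Gaussian barriers (tree files `PineauVicolWeightPositivity`, `PineauVicolWeightBounds`
for `J = 0`), normalisation and the gradient bound.

References: B. Pineau, V. Vicol, arXiv:2607.09619 (2026), Prop. 5.1, Remark 5.2, (5.1)–(5.2);
L. C. Evans, *Partial Differential Equations* (2010), §6.2 (Lax–Milgram, Fredholm alternative).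
-/

noncomputable section

open MeasureTheory TopologicalSpace Set Function Filter Topology InnerProductSpace Real
open scoped RealInnerProductSpace ENNReal NNReal ContDiff Distributions

namespace Summit.NavierStokesRegularity.NavierStokesRegularity.Theorems

open Literature.Analysis.FluidPDE Literature.Analysis.FluidPDE.PineauVicol2026

variable {E : Type*} [NormedAddCommGroup E] [InnerProductSpace ℝ E] [FiniteDimensional ℝ E]
  [MeasurableSpace E] [BorelSpace E]

variable {U : E → E} {C₀ : ℝ}

/-- **Existence of a nonzero weak solution of the twisted equation in `V`.** Under `DriftHyp U C₀`
and for a skew continuous linear `J`, there is `x = (f, G) ∈ V`, `f ≠ 0`, with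
`a_{μ₀}(x, x') + R(x, x') = μ₀ ⟪f, x'₁⟫` for all `x' ∈ V` — i.e. `(a + R)(x, ·) = 0` on `V` — where
`R (f,G) (f',G') = ∫ γ ⟪G, f' J y⟫` (Lax–Milgram for the coercive form `a_{μ₀} + R`, compactness of
`V ↪ L²(γ)`, `(a + R)(·, (1,0)) = μ₀⟪·₁, 1⟫`, Fredholm alternative). [folklore] -/
theorem exists_weak_solution_rot (h : DriftHyp U C₀) {J : E →L[ℝ] E} (hJ : ∀ v, ⟪J v, v⟫ = 0) :
    ∃ x ∈ gaussGraph (E := E), x.fst ≠ 0 ∧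
      ∀ x' ∈ gaussGraph (E := E), formBilin h.continuous h.norm_le h.abs_inner_le x x' +
        (∫ y, gaussWeight y * ⟪((x.snd : GaussL2Vec E) : E → E) y, (((x'.fst : GaussL2 E) : E → ℝ) y) • J y⟫) =
        shiftConst C₀ * ⟪x.fst, x'.fst⟫ := by
  obtain ⟨R, hRint, hRdiag, hRone⟩ := exists_skewForm (E := E) hJ
  have hC₀ := h.nonneg
  set a := formBilinV (E := E) h.continuous h.norm_le h.abs_inner_le with ha
  set B : gaussGraph (E := E) →L[ℝ] gaussGraph (E := E) →L[ℝ] ℝ := a + R with hB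
  have hBapply : ∀ v v' : gaussGraph (E := E), B v v' =
      formBilin h.continuous h.norm_le h.abs_inner_le (v : GaussProd E) (v' : GaussProd E) + R v v' := by
    intro v v'
    rw [hB, _root_.add_apply, _root_.add_apply, ha, formBilinV_apply]
  -- coercivity with the same constant: the skew form drops out on the diagonal
  have hBco : IsCoercive B := by
    refine ⟨1 / 2, by norm_num, fun v => ?_⟩
    have h1 := half_norm_sq_le_formBilin h.continuous h.norm_le h.abs_inner_le hC₀ (v : GaussProd E)
    rw [hBapply, hRdiag, add_zero, Submodule.coe_norm]
    nlinarith
  -- the solution operator `T : L²(γ) → V`, `B (T g) v' = ⟪g, v'₁⟫`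
  set T : GaussL2 E →L[ℝ] gaussGraph (E := E) :=
    (hBco.continuousLinearEquivOfBilin.symm : gaussGraph (E := E) →L[ℝ] gaussGraph (E := E)).comp
      (ContinuousLinearMap.adjoint (gaussFstL (E := E))) with hT
  have hTeq : ∀ (g : GaussL2 E) (v' : gaussGraph (E := E)), B (T g) v' = ⟪g, gaussFstL v'⟫ := by
    intro g v'
    rw [hT, ContinuousLinearMap.comp_apply, ContinuousLinearEquiv.coe_coe,
      ← IsCoercive.continuousLinearEquivOfBilin_apply hBco, ContinuousLinearEquiv.apply_symm_apply,
      ContinuousLinearMap.adjoint_inner_left]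
  -- `K = π₁ ∘ T` is compact
  set K : GaussL2 E →L[ℝ] GaussL2 E := (gaussFstL (E := E)).comp T with hK
  have hKapply : ∀ g, K g = gaussFstL (T g) := fun g => rfl
  have hKc : IsCompactOperator K := (isCompactOperator_gaussFstL (E := E)).comp_clm T
  -- `K† 1 = μ₀⁻¹ 1`
  set one : gaussGraph (E := E) := ⟨gaussOnePair, gaussOnePair_mem_gaussGraph⟩ with hone
  have hμ := (shiftConst_pos C₀).ne'
  have hadj : ContinuousLinearMap.adjoint K gaussOne = (shiftConst C₀)⁻¹ • (gaussOne : GaussL2 E) := by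
    refine ext_inner_right ℝ fun g => ?_
    rw [ContinuousLinearMap.adjoint_inner_left, real_inner_smul_left, hKapply]
    have h1 := hTeq g one
    rw [hBapply, hRone, add_zero] at h1
    change formBilin h.continuous h.norm_le h.abs_inner_le (T g : GaussProd E) gaussOnePair =
      ⟪g, gaussOne⟫ at h1
    rw [h.formBilin_gaussOnePair (T g).2] at h1
    rw [real_inner_comm (gaussFstL (T g)) gaussOne, real_inner_comm g gaussOne, ← h1, gaussFstL_apply]
    field_simp
  -- `μ₀⁻¹` is an eigenvalue of `K` (Fredholm alternative)
  have heig : Module.End.HasEigenvalue (K : Module.End ℝ (GaussL2 E)) (shiftConst C₀)⁻¹ := by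
    rcases hKc.hasEigenvalue_or_mem_resolventSet (inv_ne_zero hμ) with he | hr
    · exact he
    · exfalso
      have hadj' : Module.End.HasEigenvalue
          ((ContinuousLinearMap.adjoint K : GaussL2 E →L[ℝ] GaussL2 E) : Module.End ℝ (GaussL2 E))
          (shiftConst C₀)⁻¹ := by
        refine Module.End.hasEigenvalue_of_hasEigenvector ⟨?_, gaussOne_ne_zero⟩
        rw [Module.End.mem_eigenspace_iff]
        exact hadj
      have hspec := hadj'.mem_spectrum
      rw [← ContinuousLinearMap.spectrum_eq] at hspec
      have hr' : (shiftConst C₀)⁻¹ ∈ resolventSet ℝ (star K) := by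
        rw [← spectrum.star_mem_resolventSet_iff, star_trivial]
        exact hr
      rw [ContinuousLinearMap.star_eq_adjoint] at hr'
      exact hspec hr'
  -- an eigenvector gives the weak solution
  obtain ⟨g, hg⟩ := heig.exists_hasEigenvector
  have hKg : K g = (shiftConst C₀)⁻¹ • g := hg.apply_eq_smul
  have hg0 : g ≠ 0 := hg.2
  have hfst : ((T g : GaussProd E)).fst = (shiftConst C₀)⁻¹ • g := by
    rw [← gaussFstL_apply, ← hKapply, hKg]
  refine ⟨(T g : GaussProd E), (T g).2, ?_, fun x' hx' => ?_⟩
  · rw [hfst]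
    exact smul_ne_zero (inv_ne_zero hμ) hg0
  · have h1 := hTeq g ⟨x', hx'⟩
    rw [hBapply, hRint] at h1
    change formBilin _ _ _ (T g : GaussProd E) x' +
      (∫ y, gaussWeight y * ⟪(((T g : GaussProd E).snd : GaussL2Vec E) : E → E) y,
        (((x'.fst : GaussL2 E) : E → ℝ) y) • J y⟫) = ⟪g, x'.fst⟫ at h1
    rw [h1, hfst, real_inner_smul_left]
    field_simp

/-- **The twisted weak solution, unbundled** (rotating-gauge version of the tree's
`DriftHyp.exists_weak_solution_fun`). Under `DriftHyp U C₀` and for a skew continuous linear field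
`J` (`⟪J v, v⟫ = 0`; for the rotating conjugate density `J = α • rotGenL`) there are
`f ∈ L²(γ)`, not a.e. zero, and `G ∈ L²(γ; E)` such that: `G` is the `γ`-weak gradient of `f`
(`∫γ⟪G,Ψ⟫ = −∫γ f (div Ψ − ½⟪Ψ,y⟫)` for bounded `C¹` fields with bounded divergence);
`γ |y|² f²` is integrable (Hardy on `V`); and the **twisted weak equation**
`∫γ⟪G,∇φ⟫ − ∫γ⟪U,G⟫φ + ∫γ⟪J y, G⟫φ + ∫γ ½⟪U,y⟫ f φ = 0` holds for every smooth compactly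
supported `φ` — the weak form of `−Δv + (½y − U + Jy)·∇v + ½(U·y)v = 0`, `v = f`, i.e. of
`Δ(γv) + div((γv)(U + ½y − Jy)) = 0` (Pineau–Vicol 2026, (5.1)–(5.2) and Remark 5.2, in the
rotating gauge). [cite: PineauVicol2026, Prop. 5.1 / (5.2) and Remark 5.2] -/
theorem exists_weak_solution_fun_rot (h : DriftHyp U C₀) {J : E →L[ℝ] E} (hJ : ∀ v, ⟪J v, v⟫ = 0) :
    ∃ (f : E → ℝ) (G : E → E),
    MemLp f 2 (gaussMeasure (E := E)) ∧ MemLp G 2 (gaussMeasure (E := E)) ∧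
    (¬ f =ᵐ[volume] 0) ∧
    (∀ (Ψ : E → E) (C : ℝ), ContDiff ℝ 1 Ψ → (∀ y, ‖Ψ y‖ ≤ C) →
      (∀ y, |VectorCalculus.divergence Ψ y| ≤ C) →
        ∫ y, gaussWeight y * ⟪G y, Ψ y⟫ =
          -∫ y, gaussWeight y * (f y * (VectorCalculus.divergence Ψ y - ⟪Ψ y, y⟫ / 2))) ∧
    Integrable (fun y => gaussWeight y * (‖y‖ ^ 2 * f y ^ 2)) ∧
    (∀ φ : E → ℝ, ContDiff ℝ ∞ φ → HasCompactSupport φ →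
      (∫ y, gaussWeight y * ⟪G y, gradient φ y⟫) - (∫ y, gaussWeight y * (⟪U y, G y⟫ * φ y)) +
        (∫ y, gaussWeight y * (⟪J y, G y⟫ * φ y)) +
        (∫ y, gaussWeight y * (⟪U y, y⟫ / 2 * f y * φ y)) = 0) := by
  obtain ⟨x, hx, hx0, hxeq⟩ := exists_weak_solution_rot h hJ
  refine ⟨(x.fst : E → ℝ), (x.snd : E → E), Lp.memLp _, Lp.memLp _, ?_, ?_,
    integrable_hardy_of_mem_gaussGraph hx, ?_⟩
  · intro h0
    exact hx0 (Lp.eq_zero_iff_ae_eq_zero.2 (gaussMeasure_absolutelyContinuous.ae_le h0))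
  · intro Ψ C hΨ hbΨ hdΨ
    exact gaussGraph_integral_inner_eq hx hΨ hbΨ hdΨ
  · intro φ hφ hφc
    set ψ := mkTest φ hφ hφc with hψ
    have h1 := hxeq (testPair ψ) (testPair_mem_gaussGraph ψ)
    rw [formBilin_apply'] at h1
    have h2 : ⟪mulPotL h.continuous h.abs_inner_le x.fst, (testPair ψ).fst⟫ -
        ⟪mulInnerL h.continuous h.norm_le x.snd, (testPair ψ).fst⟫ + ⟪x.snd, (testPair ψ).snd⟫ +
        (∫ y, gaussWeight y * ⟪((x.snd : GaussL2Vec E) : E → E) y,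
          ((((testPair ψ).fst : GaussL2 E) : E → ℝ) y) • J y⟫) = 0 := by
      linarith
    rw [inner_gaussL2, inner_gaussL2, inner_gaussL2Vec] at h2
    have e1 : ∫ y, gaussWeight y * (((mulPotL h.continuous h.abs_inner_le x.fst : GaussL2 E) : E → ℝ) y *
        (((testPair ψ).fst : GaussL2 E) : E → ℝ) y) = ∫ y, gaussWeight y * (⟪U y, y⟫ / 2 * (x.fst : E → ℝ) y * φ y) := by
      refine integral_congr_ae ?_
      filter_upwards [ae_gaussMeasure_iff.1 (coeFn_mulPotL h.continuous h.abs_inner_le x.fst),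
        ae_gaussMeasure_iff.1 (coeFn_testPair_fst ψ)] with y h1 h2
      rw [h1, h2, hψ, coe_mkTest]
    have e2 : ∫ y, gaussWeight y * (((mulInnerL h.continuous h.norm_le x.snd : GaussL2 E) : E → ℝ) y *
        (((testPair ψ).fst : GaussL2 E) : E → ℝ) y) = ∫ y, gaussWeight y * (⟪U y, (x.snd : E → E) y⟫ * φ y) := by
      refine integral_congr_ae ?_
      filter_upwards [ae_gaussMeasure_iff.1 (coeFn_mulInnerL h.continuous h.norm_le x.snd),
        ae_gaussMeasure_iff.1 (coeFn_testPair_fst ψ)] with y h1 h2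
      rw [h1, h2, hψ, coe_mkTest]
    have e3 : ∫ y, gaussWeight y * ⟪((x.snd : GaussL2Vec E) : E → E) y, (((testPair ψ).snd : GaussL2Vec E) : E → E) y⟫ =
        ∫ y, gaussWeight y * ⟪(x.snd : E → E) y, gradient φ y⟫ := by
      refine integral_congr_ae ?_
      filter_upwards [ae_gaussMeasure_iff.1 (coeFn_testPair_snd ψ)] with y h1
      rw [h1, hψ, coe_mkTest]
    have e4 : ∫ y, gaussWeight y * ⟪((x.snd : GaussL2Vec E) : E → E) y,
        ((((testPair ψ).fst : GaussL2 E) : E → ℝ) y) • J y⟫ =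
        ∫ y, gaussWeight y * (⟪J y, (x.snd : E → E) y⟫ * φ y) := by
      refine integral_congr_ae ?_
      filter_upwards [ae_gaussMeasure_iff.1 (coeFn_testPair_fst ψ)] with y h1
      rw [h1, hψ, coe_mkTest, real_inner_smul_right, real_inner_comm]
      ring
    rw [e1, e2, e3, e4] at h2
    linarith

/-- **Registered form (B2 tool stub `rotatingDensity_weakSolution`, physical space `ℝ³`,
`J = α • rotGenL`).** For a smooth bounded divergence-free drift `U` on `ℝ³` with `|U| ≤ C₀`,
`|U·y| ≤ C₀` (`DriftHyp U C₀`) and any angular speed `α`: a nonzero `f ∈ L²(γ)` with `γ`-weak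
gradient `G ∈ L²(γ; ℝ³)`, `γ|y|²f²` integrable, solving the weak form of
`Δ(γf) + div((γf)(U + ½y − α rotGen y)) = 0`:
`∫γ⟪G,∇φ⟫ − ∫γ⟪U,G⟫φ + α ∫γ⟪rotGen y, G⟫φ + ∫γ ½⟪U,y⟫ f φ = 0` for all test functions. [cite: PineauVicol2026, Prop. 5.1 / (5.2) and Remark 5.2] -/
theorem rotatingDensity_weakSolution :
    ∀ (U : EuclideanSpace ℝ (Fin 3) → EuclideanSpace ℝ (Fin 3)) (C₀ α : ℝ), Literature.Analysis.FluidPDE.PineauVicol2026.DriftHyp U C₀ → ∃ (f : EuclideanSpace ℝ (Fin 3) → ℝ) (G : EuclideanSpace ℝ (Fin 3) → EuclideanSpace ℝ (Fin 3)), MeasureTheory.MemLp f 2 (Literature.Analysis.FluidPDE.PineauVicol2026.gaussMeasure (E := EuclideanSpace ℝ (Fin 3))) ∧ MeasureTheory.MemLp G 2 (Literature.Analysis.FluidPDE.PineauVicol2026.gaussMeasure (E := EuclideanSpace ℝ (Fin 3))) ∧ (¬ f =ᵐ[MeasureTheory.volume] 0) ∧ (∀ (Ψ : EuclideanSpace ℝ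 (Fin 3) → EuclideanSpace ℝ (Fin 3)) (C : ℝ), ContDiff ℝ 1 Ψ → (∀ y, ‖Ψ y‖ ≤ C) → (∀ y, |Literature.Analysis.FluidPDE.VectorCalculus.divergence Ψ y| ≤ C) → ∫ y, Literature.Analysis.FluidPDE.PineauVicol2026.gaussWeight y * inner ℝ (G y) (Ψ y) = -∫ y, Literature.Analysis.FluidPDE.PineauVicol2026.gaussWeight y * (f y * (Literature.Analysis.FluidPDE.VectorCalculus.divergence Ψ y - inner ℝ (Ψ y) y / 2))) ∧ MeasureTheory.Integrable (fun y => Literature.Analysis.FluidPDE.PineauVicol2026.gaussWeight y * (‖y‖ ^ 2 * f y ^ 2)) ∧ (∀ φ : EuclideanSpace ℝ (Fin 3) → ℝ, ContDiff ℝ (⊤ : ℕ∞) φ → HasCompactSupport φ → (∫ y, Literature.Analysis.FluidPDE.PineauVicol2026.gaussWeight y * inner ℝ (G y) (gradient φ y)) - (∫ y, Literature.Analysis.FluidPDE.PineauVicol2026.gaussWeight y * (inner ℝ (U y) (G y) * φ y)) + α * (∫ y, Literature.Analysis.FluidPDE.PineauVicol2026.gaussWeight y * (inner ℝ (Literature.Analysis.FluidPDE.rotGen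 y) (G y) * φ y)) + (∫ y, Literature.Analysis.FluidPDE.PineauVicol2026.gaussWeight y * (inner ℝ (U y) y / 2 * f y * φ y)) = 0) := by
  intro U C₀ α h
  have hJ : ∀ v : EuclideanSpace ℝ (Fin 3), ⟪(α • rotGenL) v, v⟫ = 0 := fun v => by
    rw [_root_.FunLike.coe_smul, Pi.smul_apply, rotGenL_apply, real_inner_smul_left, inner_rotGen_self, mul_zero]
  obtain ⟨f, G, hf, hG, hf0, hgrad, hhardy, hweak⟩ := exists_weak_solution_fun_rot h hJ
  refine ⟨f, G, hf, hG, hf0, hgrad, hhardy, fun φ hφ hφc => ?_⟩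
  have e := hweak φ hφ hφc
  have e1 : ∫ y, gaussWeight y * (⟪(α • rotGenL) y, G y⟫ * φ y) =
      α * ∫ y, gaussWeight y * (⟪rotGen y, G y⟫ * φ y) := by
    rw [← integral_const_mul]
    refine integral_congr_ae (Eventually.of_forall fun y => ?_)
    simp only [_root_.FunLike.coe_smul, Pi.smul_apply, rotGenL_apply, real_inner_smul_left]
    ring
  rw [e1] at e
  exact e

end Summit.NavierStokesRegularity.NavierStokesRegularity.Theorems
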